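import Mathlib.Analysis.Complex.CauchyIntegral
import Mathlib.Analysis.Complex.RemovableSingularity
import Mathlib.Analysis.SpecialFunctions.Complex.LogDeriv
import Mathlib.Analysis.SpecialFunctions.Integrals.Basic
import Mathlib.Analysis.Normed.Module.Ball.Pointwise
import Mathlib.MeasureTheory.Integral.CircleIntegral
import Literature.Analysis.Complex.LogDerivZerosDisc
import Literature.Analysis.Complex.LogNormZerosDisc
import Literature.Analysis.Complex.LogDerivZeros
import HarnessLib

/-!
# The Jensen–Carleman formula for `Re f'/f` at the centre of a disc (Heath-Brown's Lemma 3.2)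

Topic `Literature/Analysis/Complex`. Everything in this file is PROVED (no named fact).

D. R. Heath-Brown, *Zero-free regions for Dirichlet `L`-functions, and the least prime in an
arithmetic progression*, Proc. London Math. Soc. (3) 64 (1992), 265–338, **Lemma 3.2**:
"Let `f(z)` be holomorphic for `|z − a| ≤ R`, and non-vanishing both at `z = a` and on the circle
`|z − a| = R`. Let `z_k = a + r_k exp(iθ_k)` be the zeros of `f(z)` in the disc, and let `z_k` have
multiplicity `n_k`. Then

  `Re f'/f(a) = − ∑ n_k (r_k⁻¹ − r_k R⁻²) cos θ_k + (1/πR) ∫₀^{2π} (cos θ) log|f(a + Re^{iθ})| dθ`."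

Since `−(r_k⁻¹ − r_k/R²) cos θ_k = Re(1/(a − z_k) + (z_k − a)/R²)`, we state it as

  `Re f'/f(a) = ∑_k n_k Re(1/(a − z_k) + (z_k − a)/R²) + (1/πR) ∫₀^{2π} cos θ · log‖f(a + Re^{iθ})‖ dθ`

(`re_logDeriv_eq_sum_add_integral`), the zeros being the support of Mathlib's
`MeromorphicOn.divisor f (closedBall a R)` with its multiplicities (the convention of the tree's
`Literature/Analysis/Complex/LogDerivZerosDisc.lean`). Heath-Brown proves it from the contour integral
`∮ (z⁻¹ − zR⁻²) f'/f` integrated by parts against `log f`; we avoid the branch of `log f` along the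
circle: dividing out the zeros (`Literature.Analysis.Complex.exists_eq_prod_pow_sub_mul`), `f = P · G`
with `P = ∏ (z − z_k)^{n_k}` and `G` zero-free, so that `log‖G‖ = log‖G(a)‖ + Re φ` for a holomorphic
logarithm `φ` of `G/G(a)` on a slightly larger disc (`Literature.Analysis.Complex.exists_log_on_ball`);
then `∫ cos θ · φ(a + Re^{iθ}) dθ = πR φ'(a)` by Cauchy's formulae for `φ(a)`-free and `φ'(a)`
(`integral_cos_mul_eq_of_differentiableOn`), while for a single zero
`∫₀^{2π} cos θ · log‖Re^{iθ} − w‖ dθ = −π Re(w)/R` (`integral_cos_mul_log_norm_circleMap_sub`, from the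
holomorphic logarithm `log(R − w̄ z)` on `|z| ≤ 1`).

Also recorded, for the use Heath-Brown makes of the lemma (his (3.7): "we may discard zeros …
since `Re(1/(s₀−ρ) − (s₀−ρ)/R²) = (σ₀ − β)(1/|s₀−ρ|² − 1/R²) ≥ 0`"):
`re_inv_sub_add_div_sq_nonneg` — each zero term is `≥ 0` when `Re z_k ≤ Re a`.

## References

* D. R. Heath-Brown, Proc. London Math. Soc. (3) 64 (1992), Lemma 3.2 and (3.3)–(3.4), (3.7).
  [cite: HeathBrown1992PLMS, Lemma 3.2]
* E. C. Titchmarsh, *The Theory of Functions*, 2nd ed., §3.61 (Jensen), §3.71 (Carleman).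
-/

noncomputable section

open Complex MeasureTheory Set Metric Filter Topology Real intervalIntegral

namespace Literature.Analysis.Complex

namespace JensenCarleman

/-! ### Two circle integrals: `∫ e^{iθ} φ = 0`, `∫ e^{-iθ} φ = 2πR φ'(c)` -/

/-- For `φ` holomorphic on `|z − c| ≤ R` (`R > 0`): `∫₀^{2π} e^{iθ} φ(c + Re^{iθ}) dθ = 0`
(Cauchy's theorem `∮ φ = 0` on the circle, `dz = iRe^{iθ} dθ`). [folklore] -/
theorem integral_exp_mul_eq_zero {φ : ℂ → ℂ} {c : ℂ} {R : ℝ} (hR : 0 < R)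
    (hφ : DifferentiableOn ℂ φ (closedBall c R)) :
    ∫ θ in (0 : ℝ)..2 * π, Complex.exp (θ * I) * φ (circleMap c R θ) = 0 := by
  have h0 : (∮ z in C(c, R), φ z) = 0 :=
    Complex.circleIntegral_eq_zero_of_differentiable_on_off_countable hR.le countable_empty
      hφ.continuousOn fun z hz => hφ.differentiableAt (closedBall_mem_nhds_of_mem hz.1)
  rw [circleIntegral] at h0
  have h1 : (∫ θ in (0 : ℝ)..2 * π, deriv (circleMap c R) θ • φ (circleMap c R θ)) =
      (R * I) * ∫ θ in (0 : ℝ)..2 * π, Complex.exp (θ * I) * φ (circleMap c R θ) := by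
    rw [← intervalIntegral.integral_const_mul]
    refine intervalIntegral.integral_congr fun θ _ => ?_
    simp only [deriv_circleMap, circleMap_zero, smul_eq_mul]
    ring
  rw [h1] at h0
  have hRI : (R : ℂ) * I ≠ 0 := mul_ne_zero (by exact_mod_cast hR.ne') I_ne_zero
  exact (mul_eq_zero.1 h0).resolve_left hRI

/-- For `φ` holomorphic on `|z − c| ≤ R` (`R > 0`): `∫₀^{2π} e^{-iθ} φ(c + Re^{iθ}) dθ = 2πR φ'(c)`
(Cauchy's formula for the derivative, `∮ φ/(z−c)² = 2πi φ'(c)`). [folklore] -/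
theorem integral_exp_neg_mul_eq {φ : ℂ → ℂ} {c : ℂ} {R : ℝ} (hR : 0 < R)
    (hφ : DifferentiableOn ℂ φ (closedBall c R)) :
    ∫ θ in (0 : ℝ)..2 * π, Complex.exp (-(θ * I)) * φ (circleMap c R θ) = 2 * π * R * deriv φ c := by
  have h0 := hφ.deriv_eq_smul_circleIntegral hR
  rw [circleIntegral] at h0
  have h1 : (∫ θ in (0 : ℝ)..2 * π,
      deriv (circleMap c R) θ • ((1 / (circleMap c R θ - c) ^ 2) • φ (circleMap c R θ))) =
      (I / R) * ∫ θ in (0 : ℝ)..2 * π, Complex.exp (-(θ * I)) * φ (circleMap c R θ) := by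
    rw [← intervalIntegral.integral_const_mul]
    refine intervalIntegral.integral_congr fun θ _ => ?_
    simp only [deriv_circleMap, circleMap_sub_center, circleMap_zero, smul_eq_mul]
    have hR0 : (R : ℂ) ≠ 0 := by exact_mod_cast hR.ne'
    have hE : Complex.exp (θ * I) ≠ 0 := Complex.exp_ne_zero _
    rw [Complex.exp_neg]
    field_simp
  rw [h1, smul_eq_mul] at h0
  have hIR : I / (R : ℂ) ≠ 0 := div_ne_zero I_ne_zero (by exact_mod_cast hR.ne')
  have hR0 : (R : ℂ) ≠ 0 := by exact_mod_cast hR.ne'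
  have key : (∫ θ in (0 : ℝ)..2 * π, Complex.exp (-(θ * I)) * φ (circleMap c R θ)) =
      (I / R)⁻¹ * ((2 * π * I) * deriv φ c) := by
    rw [eq_inv_mul_iff_mul_eq₀ hIR, h0]
  rw [key, inv_div]
  field_simp

/-- **`∫₀^{2π} cos θ · φ(c + Re^{iθ}) dθ = πR φ'(c)`** for `φ` holomorphic on `|z − c| ≤ R`, `R > 0`.
[folklore] -/
theorem integral_cos_mul_eq_of_differentiableOn {φ : ℂ → ℂ} {c : ℂ} {R : ℝ} (hR : 0 < R)
    (hφ : DifferentiableOn ℂ φ (closedBall c R)) :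
    ∫ θ in (0 : ℝ)..2 * π, (Real.cos θ : ℂ) * φ (circleMap c R θ) = π * R * deriv φ c := by
  have hcont : Continuous fun θ : ℝ => φ (circleMap c R θ) :=
    hφ.continuousOn.comp_continuous (continuous_circleMap c R)
      fun θ => circleMap_mem_closedBall c hR.le θ
  have hce : Continuous fun θ : ℝ => Complex.exp (θ * I) :=
    Complex.continuous_exp.comp (Complex.continuous_ofReal.mul continuous_const)
  have hce' : Continuous fun θ : ℝ => Complex.exp (-(θ * I)) :=
    Complex.continuous_exp.comp (Complex.continuous_ofReal.mul continuous_const).neg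
  have hi1 : IntervalIntegrable (fun θ : ℝ => Complex.exp (θ * I) * φ (circleMap c R θ)) volume 0 (2 * π) :=
    (hce.mul hcont).intervalIntegrable _ _
  have hi2 : IntervalIntegrable (fun θ : ℝ => Complex.exp (-(θ * I)) * φ (circleMap c R θ)) volume 0 (2 * π) :=
    (hce'.mul hcont).intervalIntegrable _ _
  have hsplit : (fun θ : ℝ => (Real.cos θ : ℂ) * φ (circleMap c R θ)) = fun θ : ℝ =>
      (1 / 2 : ℂ) * (Complex.exp (θ * I) * φ (circleMap c R θ)) +
        (1 / 2 : ℂ) * (Complex.exp (-(θ * I)) * φ (circleMap c R θ)) := by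
    funext θ
    rw [Complex.ofReal_cos]
    have h2 := Complex.two_cos (θ : ℂ)
    rw [neg_mul] at h2
    have : Complex.cos (θ : ℂ) = (Complex.exp (θ * I) + Complex.exp (-(θ * I))) / 2 := by
      rw [← h2]; ring
    rw [this]
    ring
  rw [hsplit, intervalIntegral.integral_add (hi1.const_mul _) (hi2.const_mul _),
    intervalIntegral.integral_const_mul, intervalIntegral.integral_const_mul,
    integral_exp_mul_eq_zero hR hφ, integral_exp_neg_mul_eq hR hφ]
  ring

/-- Real form: `∫₀^{2π} cos θ · Re φ(c + Re^{iθ}) dθ = πR · Re φ'(c)`. [folklore] -/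
theorem integral_cos_mul_re_eq {φ : ℂ → ℂ} {c : ℂ} {R : ℝ} (hR : 0 < R)
    (hφ : DifferentiableOn ℂ φ (closedBall c R)) :
    ∫ θ in (0 : ℝ)..2 * π, Real.cos θ * (φ (circleMap c R θ)).re = π * R * (deriv φ c).re := by
  have hcont : Continuous fun θ : ℝ => φ (circleMap c R θ) :=
    hφ.continuousOn.comp_continuous (continuous_circleMap c R)
      fun θ => circleMap_mem_closedBall c hR.le θ
  have hint : IntervalIntegrable (fun θ : ℝ => (Real.cos θ : ℂ) * φ (circleMap c R θ)) volume 0 (2 * π) :=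
    ((Complex.continuous_ofReal.comp Real.continuous_cos).mul hcont).intervalIntegrable _ _
  have h1 : (fun θ : ℝ => Real.cos θ * (φ (circleMap c R θ)).re) =
      fun θ => Complex.reCLM ((Real.cos θ : ℂ) * φ (circleMap c R θ)) := by
    funext θ
    rw [Complex.reCLM_apply, Complex.re_ofReal_mul]
  rw [h1, ContinuousLinearMap.intervalIntegral_comp_comm _ hint,
    integral_cos_mul_eq_of_differentiableOn hR hφ]
  simp [Complex.mul_re]

/-! ### The integral for a single zero -/

/-- For `‖w‖ < R`: **`∫₀^{2π} cos θ · log‖Re^{iθ} − w‖ dθ = −π Re(w)/R`**. Proof: `‖Re^{iθ} − w‖ =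
‖R − w̄ e^{iθ}‖` and `z ↦ log(R − w̄ z)` is holomorphic on `|z| ≤ 1` with derivative `−w̄/R` at `0`.
[folklore] -/
theorem integral_cos_mul_log_norm_sub {w : ℂ} {R : ℝ} (hw : ‖w‖ < R) :
    ∫ θ in (0 : ℝ)..2 * π, Real.cos θ * Real.log ‖(R : ℂ) * Complex.exp (θ * I) - w‖ = -π * w.re / R := by
  have hR : 0 < R := (norm_nonneg w).trans_lt hw
  set H : ℂ → ℂ := fun z => Complex.log (R - starRingEnd ℂ w * z) with hH
  -- `R − w̄ z` has positive real part on `|z| ≤ 1`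
  have hpos : ∀ z ∈ closedBall (0 : ℂ) 1, 0 < ((R : ℂ) - starRingEnd ℂ w * z).re := by
    intro z hz
    rw [mem_closedBall, dist_zero_right] at hz
    have h1 : ‖starRingEnd ℂ w * z‖ ≤ ‖w‖ := by
      rw [norm_mul, Complex.norm_conj]
      calc ‖w‖ * ‖z‖ ≤ ‖w‖ * 1 := by gcongr
        _ = ‖w‖ := mul_one _
    have h2 : |(starRingEnd ℂ w * z).re| ≤ ‖w‖ := (abs_re_le_norm _).trans h1
    simp only [Complex.sub_re, Complex.ofReal_re]
    have := le_abs_self (starRingEnd ℂ w * z).re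
    linarith
  have hslit : ∀ z ∈ closedBall (0 : ℂ) 1, ((R : ℂ) - starRingEnd ℂ w * z) ∈ slitPlane :=
    fun z hz => Or.inl (hpos z hz)
  have hHd : DifferentiableOn ℂ H (closedBall 0 1) := by
    intro z hz
    have hin : DifferentiableAt ℂ (fun z => (R : ℂ) - starRingEnd ℂ w * z) z := by fun_prop
    exact ((hin.clog (hslit z hz))).differentiableWithinAt
  have hderiv : deriv H 0 = -(starRingEnd ℂ w) / R := by
    have hin : HasDerivAt (fun z => (R : ℂ) - starRingEnd ℂ w * z) (-(starRingEnd ℂ w)) 0 := by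
      simpa using ((hasDerivAt_id (0 : ℂ)).const_mul (starRingEnd ℂ w)).const_sub (R : ℂ)
    have h := hin.clog (hslit 0 (mem_closedBall_self zero_le_one))
    rw [h.deriv]
    simp
  have key := integral_cos_mul_re_eq (φ := H) (c := 0) (R := 1) one_pos hHd
  -- identify the integrand
  have hid : ∀ θ : ℝ, (H (circleMap 0 1 θ)).re = Real.log ‖(R : ℂ) * Complex.exp (θ * I) - w‖ := by
    intro θ
    simp only [hH, circleMap_zero, Complex.ofReal_one, one_mul, Complex.log_re]
    congr 1
    have h1 : (R : ℂ) * Complex.exp (θ * I) - w = Complex.exp (θ * I) * ((R : ℂ) - w * Complex.exp (-(θ * I))) := by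
      have he : Complex.exp (θ * I) * Complex.exp (-(θ * I)) = 1 := by
        rw [← Complex.exp_add, add_neg_cancel, Complex.exp_zero]
      calc (R : ℂ) * Complex.exp (θ * I) - w
          = Complex.exp (θ * I) * R - w * (Complex.exp (θ * I) * Complex.exp (-(θ * I))) := by
            rw [he, mul_one, mul_comm]
        _ = Complex.exp (θ * I) * ((R : ℂ) - w * Complex.exp (-(θ * I))) := by ring
    have h2 : ‖(R : ℂ) - w * Complex.exp (-(θ * I))‖ = ‖(R : ℂ) - starRingEnd ℂ w * Complex.exp (θ * I)‖ := by
      rw [← Complex.norm_conj ((R : ℂ) - w * Complex.exp (-(θ * I)))]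
      congr 1
      simp only [map_sub, Complex.conj_ofReal, map_mul]
      congr 2
      rw [← Complex.exp_conj]
      congr 1
      simp [Complex.conj_ofReal]
    rw [h1, norm_mul, Complex.norm_exp_ofReal_mul_I, one_mul, h2]
  simp_rw [hid] at key
  rw [key, hderiv]
  simp only [mul_one, Complex.neg_re, Complex.div_ofReal_re, Complex.conj_re, neg_div]
  ring

/-- The same with centre `c` and Mathlib's `circleMap`: for `‖u − c‖ < R`,
`∫₀^{2π} cos θ · log‖circleMap c R θ − u‖ dθ = −π Re(u − c)/R`. [folklore] -/
theorem integral_cos_mul_log_norm_circleMap_sub {u c : ℂ} {R : ℝ} (hu : ‖u - c‖ < R) :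
    ∫ θ in (0 : ℝ)..2 * π, Real.cos θ * Real.log ‖circleMap c R θ - u‖ = -π * (u - c).re / R := by
  have h := integral_cos_mul_log_norm_sub hu
  refine Eq.trans (intervalIntegral.integral_congr fun θ _ => ?_) h
  simp only [circleMap]
  congr 3
  ring

/-! ### The zero-free factor -/

/-- For `G` holomorphic on a neighbourhood of `|z − c| ≤ R` (`R > 0`) and zero-free there:
`∫₀^{2π} cos θ · log‖G(c + Re^{iθ})‖ dθ = πR · Re(G'(c)/G(c))`. [folklore] -/
theorem integral_cos_mul_log_norm_eq_of_ne_zero {G : ℂ → ℂ} {c : ℂ} {R : ℝ} (hR : 0 < R)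
    (hG : AnalyticOnNhd ℂ G (closedBall c R)) (hG0 : ∀ z ∈ closedBall c R, G z ≠ 0) :
    ∫ θ in (0 : ℝ)..2 * π, Real.cos θ * Real.log ‖G (circleMap c R θ)‖ =
      π * R * (deriv G c / G c).re := by
  -- an open set on which `G` is analytic and zero-free, containing a larger ball
  set O : Set ℂ := {z | AnalyticAt ℂ G z ∧ G z ≠ 0} with hO
  have hOopen : IsOpen O := by
    rw [isOpen_iff_mem_nhds]
    rintro z ⟨hz1, hz2⟩
    filter_upwards [hz1.eventually_analyticAt, hz1.continuousAt.eventually_ne hz2] with y hy1 hy2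
    exact ⟨hy1, hy2⟩
  have hsub : closedBall c R ⊆ O := fun z hz => ⟨hG z hz, hG0 z hz⟩
  obtain ⟨δ, hδ, hthick⟩ := (isCompact_closedBall c R).exists_thickening_subset_open hOopen hsub
  rw [thickening_closedBall hδ hR.le] at hthick
  set R' := δ + R with hR'
  have hRR' : R < R' := by rw [hR']; linarith
  have hGd : DifferentiableOn ℂ G (ball c R') := fun z hz => (hthick hz).1.differentiableAt.differentiableWithinAt
  have hG0' : ∀ z ∈ ball c R', G z ≠ 0 := fun z hz => (hthick hz).2
  obtain ⟨φ, hφd, hφc, hφ', hGφ⟩ := exists_log_on_ball hGd hG0'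
  have hsubball : closedBall c R ⊆ ball c R' := closedBall_subset_ball hRR'
  have hφR : DifferentiableOn ℂ φ (closedBall c R) := hφd.mono hsubball
  -- `log‖G z‖ = log‖G c‖ + Re φ z` on the larger ball
  have hlog : ∀ z ∈ ball c R', Real.log ‖G z‖ = Real.log ‖G c‖ + (φ z).re := by
    intro z hz
    rw [hGφ z hz, norm_mul, Complex.norm_exp, Real.log_mul (norm_ne_zero_iff.2 (hG0 c (mem_closedBall_self hR.le)))
      (Real.exp_pos _).ne', Real.log_exp]
  have hid : ∀ θ : ℝ, Real.cos θ * Real.log ‖G (circleMap c R θ)‖ =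
      Real.log ‖G c‖ * Real.cos θ + Real.cos θ * (φ (circleMap c R θ)).re := by
    intro θ
    rw [hlog _ (hsubball (circleMap_mem_closedBall c hR.le θ))]
    ring
  have hcontφ : Continuous fun θ : ℝ => (φ (circleMap c R θ)).re :=
    Complex.continuous_re.comp (hφR.continuousOn.comp_continuous (continuous_circleMap c R)
      fun θ => circleMap_mem_closedBall c hR.le θ)
  have hi1 : IntervalIntegrable (fun θ : ℝ => Real.log ‖G c‖ * Real.cos θ) volume 0 (2 * π) :=
    Continuous.intervalIntegrable (by fun_prop) _ _
  have hi2 : IntervalIntegrable (fun θ : ℝ => Real.cos θ * (φ (circleMap c R θ)).re) volume 0 (2 * π) :=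
    Continuous.intervalIntegrable (Real.continuous_cos.mul hcontφ) _ _
  simp_rw [hid]
  rw [intervalIntegral.integral_add hi1 hi2, intervalIntegral.integral_const_mul, integral_cos,
    integral_cos_mul_re_eq hR hφR]
  have hderiv : deriv φ c = deriv G c / G c := (hφ' c (mem_ball_self (hR.trans hRR'))).deriv
  rw [hderiv, Real.sin_two_pi, Real.sin_zero]
  ring

/-! ### The zero terms have a sign -/

/-- For a point `u` of the disc `|u − c| ≤ R` to the left of the centre (`Re u ≤ Re c`):
`Re(1/(c − u) + (u − c)/R²) = Re(c − u) · (1/|c − u|² − 1/R²) ≥ 0` (Heath-Brown 1992, proof of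
Lemma 3.1: "we may discard zeros from (3.7)"). [cite: HeathBrown1992PLMS, proof of Lemma 3.1 (3.7)] -/
theorem re_inv_sub_add_div_sq_nonneg {u c : ℂ} {R : ℝ} (hu : ‖u - c‖ ≤ R) (hre : u.re ≤ c.re) :
    0 ≤ (1 / (c - u) + (u - c) / (R : ℂ) ^ 2).re := by
  rcases eq_or_ne u c with rfl | hne
  · simp
  have hR : 0 < R := lt_of_lt_of_le (norm_pos_iff.2 (sub_ne_zero.2 hne)) hu
  have hcu : 0 < ‖c - u‖ := norm_pos_iff.2 (sub_ne_zero.2 hne.symm)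
  have hcu' : ‖c - u‖ ≤ R := by rwa [norm_sub_rev]
  have h1 : (1 / (c - u)).re = (c - u).re / ‖c - u‖ ^ 2 := by
    rw [one_div, Complex.inv_re, Complex.normSq_eq_norm_sq]
  have h2 : ((u - c) / (R : ℂ) ^ 2).re = -(c - u).re / R ^ 2 := by
    rw [← Complex.ofReal_pow, Complex.div_ofReal_re, Complex.sub_re, Complex.sub_re]
    ring
  rw [Complex.add_re, h1, h2]
  have hre' : 0 ≤ (c - u).re := by rw [Complex.sub_re]; linarith
  have h3 : 1 / R ^ 2 ≤ 1 / ‖c - u‖ ^ 2 := by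
    apply one_div_le_one_div_of_le (by positivity)
    exact pow_le_pow_left₀ hcu.le hcu' 2
  have : (c - u).re / ‖c - u‖ ^ 2 + -(c - u).re / R ^ 2 = (c - u).re * (1 / ‖c - u‖ ^ 2 - 1 / R ^ 2) := by
    ring
  rw [this]
  exact mul_nonneg hre' (sub_nonneg.2 h3)

end JensenCarleman

/-! ### Heath-Brown's Lemma 3.2 -/

open JensenCarleman in
/-- **The Jensen–Carleman formula (Heath-Brown 1992, Lemma 3.2).** Let `f` be holomorphic on a
neighbourhood of the closed disc `|z − c| ≤ R` (`R > 0`), with `f(c) ≠ 0` and `f ≠ 0` on the circle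
`|z − c| = R`. Let `u` run over the zeros of `f` in the disc, with multiplicities `n(u)` (the support
and the values of Mathlib's `MeromorphicOn.divisor f (closedBall c R)`). Then

  `Re f'(c)/f(c) = ∑_u n(u) Re(1/(c − u) + (u − c)/R²) + (1/(πR)) ∫₀^{2π} cos θ · log‖f(c + Re^{iθ})‖ dθ`

("`Re f'/f(a) = −∑ n_k(r_k⁻¹ − r_k R⁻²) cos θ_k + (1/πR)∫₀^{2π} (cos θ) log|f(a+Re^{iθ})| dθ`",
`u = c + r_k e^{iθ_k}`). [cite: HeathBrown1992PLMS, Lemma 3.2] -/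
theorem re_logDeriv_eq_sum_add_integral {f : ℂ → ℂ} {c : ℂ} {R : ℝ} (hR : 0 < R)
    (hf : AnalyticOnNhd ℂ f (closedBall c R)) (hc : f c ≠ 0)
    (hsph : ∀ z ∈ sphere c R, f z ≠ 0) :
    (deriv f c / f c).re =
      (∑ u ∈ ((MeromorphicOn.divisor f (closedBall c R)).finiteSupport (isCompact_closedBall c R)).toFinset,
          ((MeromorphicOn.divisor f (closedBall c R) u).toNat : ℝ) * (1 / (c - u) + (u - c) / (R : ℂ) ^ 2).re) +
        1 / (π * R) * ∫ θ in (0 : ℝ)..2 * π, Real.cos θ * Real.log ‖f (circleMap c R θ)‖ := by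
  classical
  set D := MeromorphicOn.divisor f (closedBall c R) with hD
  set S := (D.finiteSupport (isCompact_closedBall c R)).toFinset with hS
  set n : ℂ → ℕ := fun u => (D u).toNat with hn
  obtain ⟨G, hGan, hG0, hfPG⟩ := exists_eq_prod_pow_sub_mul hR le_rfl hf hc
  set P : ℂ → ℂ := fun z => ∏ u ∈ S, (z - u) ^ n u with hP
  have hfPG' : ∀ z ∈ closedBall c R, f z = P z * G z := hfPG
  -- the zeros: in the support, `D u ≥ 1`, so `P u = 0`, `f u = 0`, and `u` is inside the circle
  have hmemS : ∀ u ∈ S, u ∈ closedBall c R ∧ 1 ≤ n u := by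
    intro u hu
    rw [hS, Set.Finite.mem_toFinset, Function.mem_support] at hu
    have hin : u ∈ closedBall c R := D.supportWithinDomain (Function.mem_support.2 hu)
    have h0 : 0 ≤ D u := MeromorphicOn.AnalyticOnNhd.divisor_nonneg hf u
    refine ⟨hin, ?_⟩
    have h1 : (1 : ℤ) ≤ D u := by omega
    exact (Int.le_toNat h0).mpr h1
  have hPzero : ∀ u ∈ S, P u = 0 := by
    intro u hu
    rw [hP]
    exact Finset.prod_eq_zero hu (by rw [sub_self, zero_pow (by have := (hmemS u hu).2; omega)])
  have hinside : ∀ u ∈ S, ‖u - c‖ < R := by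
    intro u hu
    have h1 : ‖u - c‖ ≤ R := by simpa [dist_eq_norm] using (hmemS u hu).1
    rcases h1.lt_or_eq with h | h
    · exact h
    · exfalso
      have hus : u ∈ sphere c R := by rw [mem_sphere, dist_eq_norm]; exact h
      exact hsph u hus (by rw [hfPG' u (hmemS u hu).1, hPzero u hu, zero_mul])
  have hcS : ∀ u ∈ S, c ≠ u := by
    intro u hu h
    exact hc (by rw [hfPG' c (mem_closedBall_self hR.le), h, hPzero u hu, zero_mul])
  -- points of the circle are not zeros
  have hcirc : ∀ θ : ℝ, ∀ u ∈ S, circleMap c R θ ≠ u := by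
    intro θ u hu h
    have : ‖u - c‖ = R := by
      rw [← h]
      simp [circleMap, abs_of_pos hR]
    exact (hinside u hu).ne this
  -- (1) the logarithmic derivative at the centre
  have hPan : ∀ z, AnalyticAt ℂ P z := fun z => by
    apply Differentiable.analyticAt (f := P); rw [hP]; fun_prop
  have hPc : P c ≠ 0 := prod_pow_sub_ne_zero n (hcS)
  have hGc : G c ≠ 0 := hG0 c (mem_closedBall_self hR.le)
  have hderiv : deriv f c = deriv P c * G c + P c * deriv G c := by
    have hloc : f =ᶠ[𝓝 c] fun z => P z * G z := by
      filter_upwards [closedBall_mem_nhds c hR] with z hz using hfPG' z hz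
    rw [hloc.deriv_eq]
    exact deriv_mul (hPan c).differentiableAt (hGan c (mem_closedBall_self hR.le)).differentiableAt
  have hPd : deriv P c / P c = ∑ u ∈ S, (n u : ℂ) / (c - u) := deriv_prod_pow_sub_div n hcS
  have hld : deriv f c / f c = (∑ u ∈ S, (n u : ℂ) / (c - u)) + deriv G c / G c := by
    rw [hderiv, hfPG' c (mem_closedBall_self hR.le), ← hPd]
    field_simp
  -- (2) the integral: split `log‖f‖ = ∑ n(u) log‖· − u‖ + log‖G‖` on the circle
  have hlogf : ∀ θ : ℝ, Real.log ‖f (circleMap c R θ)‖ =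
      (∑ u ∈ S, (n u : ℝ) * Real.log ‖circleMap c R θ - u‖) + Real.log ‖G (circleMap c R θ)‖ := by
    intro θ
    have hz : circleMap c R θ ∈ closedBall c R := circleMap_mem_closedBall c hR.le θ
    rw [hfPG' _ hz, norm_mul, Real.log_mul (norm_ne_zero_iff.2 (prod_pow_sub_ne_zero n (hcirc θ)))
      (norm_ne_zero_iff.2 (hG0 _ hz)), log_norm_prod_pow_sub n (hcirc θ)]
  have hGcirc : Continuous fun θ : ℝ => G (circleMap c R θ) :=
    hGan.continuousOn.comp_continuous (continuous_circleMap c R)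
      fun θ => circleMap_mem_closedBall c hR.le θ
  have hcontG : Continuous fun θ : ℝ => Real.log ‖G (circleMap c R θ)‖ :=
    (continuous_norm.comp hGcirc).log fun θ =>
      norm_ne_zero_iff.2 (hG0 _ (circleMap_mem_closedBall c hR.le θ))
  have hcontu : ∀ u ∈ S, Continuous fun θ : ℝ => Real.log ‖circleMap c R θ - u‖ := fun u hu =>
    (continuous_norm.comp ((continuous_circleMap c R).sub continuous_const)).log fun θ =>
      norm_ne_zero_iff.2 (sub_ne_zero.2 (hcirc θ u hu))
  have hint_sum : ∫ θ in (0 : ℝ)..2 * π, Real.cos θ * Real.log ‖f (circleMap c R θ)‖ =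
      (∑ u ∈ S, (n u : ℝ) * (-π * (u - c).re / R)) + π * R * (deriv G c / G c).re := by
    have h1 : (fun θ : ℝ => Real.cos θ * Real.log ‖f (circleMap c R θ)‖) = fun θ =>
        (∑ u ∈ S, (n u : ℝ) * (Real.cos θ * Real.log ‖circleMap c R θ - u‖)) +
          Real.cos θ * Real.log ‖G (circleMap c R θ)‖ := by
      funext θ
      rw [hlogf θ, mul_add, Finset.mul_sum]
      congr 1
      exact Finset.sum_congr rfl fun u _ => by ring
    have hiu : ∀ u ∈ S, IntervalIntegrable
        (fun θ : ℝ => (n u : ℝ) * (Real.cos θ * Real.log ‖circleMap c R θ - u‖)) volume 0 (2 * π) :=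
      fun u hu => (continuous_const.mul (Real.continuous_cos.mul (hcontu u hu))).intervalIntegrable _ _
    have hisum : IntervalIntegrable (fun θ : ℝ =>
        ∑ u ∈ S, (n u : ℝ) * (Real.cos θ * Real.log ‖circleMap c R θ - u‖)) volume 0 (2 * π) :=
      (continuous_finsetSum _ fun u hu =>
        continuous_const.mul (Real.continuous_cos.mul (hcontu u hu))).intervalIntegrable _ _
    have hiG : IntervalIntegrable (fun θ : ℝ => Real.cos θ * Real.log ‖G (circleMap c R θ)‖)
        volume 0 (2 * π) := (Real.continuous_cos.mul hcontG).intervalIntegrable _ _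
    rw [h1, intervalIntegral.integral_add hisum hiG, intervalIntegral.integral_finsetSum hiu,
      integral_cos_mul_log_norm_eq_of_ne_zero hR hGan hG0]
    congr 1
    refine Finset.sum_congr rfl fun u hu => ?_
    rw [intervalIntegral.integral_const_mul, integral_cos_mul_log_norm_circleMap_sub (hinside u hu)]
  -- (3) assemble
  rw [hld, hint_sum, Complex.add_re, Complex.re_sum]
  have hπR : π * R ≠ 0 := mul_ne_zero Real.pi_ne_zero hR.ne'
  set A : ℝ := ∑ u ∈ S, (n u : ℝ) * (1 / (c - u)).re with hA
  set B : ℝ := ∑ u ∈ S, (n u : ℝ) * (u - c).re with hB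
  have e1 : ∑ u ∈ S, ((n u : ℂ) / (c - u)).re = A := by
    refine Finset.sum_congr rfl fun u _ => ?_
    rw [div_eq_mul_one_div, show (n u : ℂ) = ((n u : ℝ) : ℂ) by simp, Complex.re_ofReal_mul]
  have e2 : ∑ u ∈ S, (n u : ℝ) * (1 / (c - u) + (u - c) / (R : ℂ) ^ 2).re = A + B / R ^ 2 := by
    have : ∀ u ∈ S, (n u : ℝ) * (1 / (c - u) + (u - c) / (R : ℂ) ^ 2).re =
        (n u : ℝ) * (1 / (c - u)).re + (n u : ℝ) * (u - c).re / R ^ 2 := by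
      intro u _
      rw [Complex.add_re, ← Complex.ofReal_pow, Complex.div_ofReal_re]
      ring
    rw [Finset.sum_congr rfl this, Finset.sum_add_distrib, ← hA, Finset.sum_div]
  have e3 : ∑ u ∈ S, (n u : ℝ) * (-π * (u - c).re / R) = (-π / R) * B := by
    rw [hB, Finset.mul_sum]
    refine Finset.sum_congr rfl fun u _ => ?_
    ring
  rw [e1, e2, e3]
  field_simp
  ring

end Literature.Analysis.Complex

end
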